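import Summits.CriticalPhenomena.PercolationContinuityZ3.Theorems.SahiMasterFamilyPrincipalCapC3
import Literature.Probability.Percolation.FoldingFibresHarris

/-!
# Sahi's `C₄` on the principal-cap stratum: `E₄ ≥ 0` whenever `U₀ ∩ U₁ ∩ U₂ ∩ U₃` is a principal up-set

Unit `prim-masterthm-p4` (gen 12; crux anchor stmt-CriticalPhenomena-4575, helper work; memo
`run/shared/lean/prim/prim-masterthm/prim-masterthm-p4/P4-GEN12-REPORT.md`).  Companion of `…PrincipalCapC3` (order three).

**THEOREM (`sahiE4_nonneg_of_principalCap`).**  Let `A, B, C, D` be increasing events on a finite product of two-point spaces with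
PRINCIPAL common part `A ∩ B ∩ C ∩ D = {T | c ⊆ T}`.  Then Sahi's fourth-order functional
`E₄(μ_p; 1_A,1_B,1_C,1_D) = 6m_{ABCD} − 2Σ m_A m_{BCD} + Σ m_A m_B m_{CD} − Σ m_{AB}m_{CD} − m_Am_Bm_Cm_D ≥ 0` for every `p ∈ [0,1]^ι`
— Sahi's conjecture `C₄` [Sahi2008, Conj. 5] / the `k = 4` master inequality on product measures, on this stratum.

PROOF.  Disjointify the cores, `c = K_A ⊔ K_B ⊔ K_C ⊔ K_D`, `X ⊆ [K_X]`, `P_X := ∏_{K_X} p_e`; then `m_S ≤ P_S` for every sub-family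
(intersections of disjoint cylinders), `m_{ABCD} ≥ P_AP_BP_CP_D`, and Harris `m_{XY} ≥ m_X m_Y` (tree: `prodBernoulli_harris_via_fibres`).  The 16-term CERTIFICATE
(found by linear programming over products of these non-negative atoms, kit job j114855; verified exactly)
  `E₄[m_{ABCD} := P] = 2Σ_X m_X (P_{−X} − m_{−X}) + (P_{AB}−m_{AB})(m_{CD}−m_Cm_D) + (P_{AC}−m_{AC})(P_{BD}−m_{BD}) + (P_{AC}−m_{AC})(m_{BD}−m_Bm_D)
   + (P_{AD}−m_{AD})(m_{BC}−m_Bm_C) + (P_{BD}−m_{BD})(m_{AC}−m_Am_C) + (P_A−m_A)(P_D−m_D)(m_{BC}−m_Bm_C) + (P_A−m_A)(P_{BC}−m_{BC})P_D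
   + (P_A−m_A)(P_{CD}−m_{CD})P_B + m_A(P_B−m_B)(P_{CD}−m_{CD}) + (P_D−m_D)(P_{BC}−m_{BC})P_A + (P_A−m_A)(P_B−m_B)(P_C−m_C)P_D
   + (P_B−m_B)(P_C−m_C)(P_D−m_D)P_A`
is a polynomial identity (`ring`), every term is `≥ 0`, and the coefficient of `m_{ABCD}` in `E₄` is `+6`.  ∎
HONEST FRAMING: `C₄` in general and `C_k` remain OPEN; the stratum `k ≥ 5` (same certificate shape?) is a natural conjecture.
Axioms standard. [this work]
-/

noncomputable section

open scoped Classical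

namespace Summit.CriticalPhenomena.PercolationContinuityZ3.Theorems

namespace PrincipalCapC3

open Finset Function MeasureTheory
open Literature.Combinatorics.Sahi2008
open Literature.Probability.LatticeModels (prodBernoulli sahiE4 sahiE4_def prodBernoulli_real_subset)
open Literature.Probability.Percolation.DecisionTree (ind)

variable {ι : Type*} [Fintype ι]

/-- **The order-four certificate** (a polynomial identity plus sixteen non-negative products). [this work] -/
theorem key_ineq4 {m0 m1 m2 m3 m01 m02 m03 m12 m13 m23 m012 m013 m023 m123 m0123 P0 P1 P2 P3 : ℝ}
    (h0 : 0 ≤ m0) (h1 : 0 ≤ m1) (h2 : 0 ≤ m2) (h3 : 0 ≤ m3) (hP0 : 0 ≤ P0) (hP1 : 0 ≤ P1) (hP3 : 0 ≤ P3)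
    (u0 : m0 ≤ P0) (u1 : m1 ≤ P1) (u2 : m2 ≤ P2) (u3 : m3 ≤ P3)
    (u01 : m01 ≤ P0 * P1) (u02 : m02 ≤ P0 * P2) (u03 : m03 ≤ P0 * P3) (u12 : m12 ≤ P1 * P2) (u13 : m13 ≤ P1 * P3)
    (u23 : m23 ≤ P2 * P3) (u012 : m012 ≤ P0 * P1 * P2) (u013 : m013 ≤ P0 * P1 * P3) (u023 : m023 ≤ P0 * P2 * P3)
    (u123 : m123 ≤ P1 * P2 * P3) (htop : P0 * P1 * P2 * P3 ≤ m0123)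
    (k02 : m0 * m2 ≤ m02) (k12 : m1 * m2 ≤ m12) (k13 : m1 * m3 ≤ m13) (k23 : m2 * m3 ≤ m23) :
    0 ≤ 6 * m0123
      - 2 * (m0 * m123 + m1 * m023 + m2 * m013 + m3 * m012)
      + (m0 * m1 * m23 + m0 * m2 * m13 + m0 * m3 * m12 + m1 * m2 * m03 + m1 * m3 * m02 + m2 * m3 * m01)
      - (m01 * m23 + m02 * m13 + m03 * m12)
      - m0 * m1 * m2 * m3 := by
  have t1 : 0 ≤ m0 * (P1 * P2 * P3 - m123) := mul_nonneg h0 (sub_nonneg.2 u123)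
  have t2 : 0 ≤ m1 * (P0 * P2 * P3 - m023) := mul_nonneg h1 (sub_nonneg.2 u023)
  have t3 : 0 ≤ m2 * (P0 * P1 * P3 - m013) := mul_nonneg h2 (sub_nonneg.2 u013)
  have t4 : 0 ≤ m3 * (P0 * P1 * P2 - m012) := mul_nonneg h3 (sub_nonneg.2 u012)
  have t5 : 0 ≤ (P0 * P1 - m01) * (m23 - m2 * m3) := mul_nonneg (sub_nonneg.2 u01) (sub_nonneg.2 k23)
  have t6 : 0 ≤ (P0 * P2 - m02) * (P1 * P3 - m13) := mul_nonneg (sub_nonneg.2 u02) (sub_nonneg.2 u13)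
  have t7 : 0 ≤ (P0 * P2 - m02) * (m13 - m1 * m3) := mul_nonneg (sub_nonneg.2 u02) (sub_nonneg.2 k13)
  have t8 : 0 ≤ (P0 * P3 - m03) * (m12 - m1 * m2) := mul_nonneg (sub_nonneg.2 u03) (sub_nonneg.2 k12)
  have t9 : 0 ≤ (P1 * P3 - m13) * (m02 - m0 * m2) := mul_nonneg (sub_nonneg.2 u13) (sub_nonneg.2 k02)
  have t10 : 0 ≤ (P0 - m0) * (P3 - m3) * (m12 - m1 * m2) :=
    mul_nonneg (mul_nonneg (sub_nonneg.2 u0) (sub_nonneg.2 u3)) (sub_nonneg.2 k12)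
  have t11 : 0 ≤ (P0 - m0) * (P1 * P2 - m12) * P3 := mul_nonneg (mul_nonneg (sub_nonneg.2 u0) (sub_nonneg.2 u12)) hP3
  have t12 : 0 ≤ (P0 - m0) * (P2 * P3 - m23) * P1 := mul_nonneg (mul_nonneg (sub_nonneg.2 u0) (sub_nonneg.2 u23)) hP1
  have t13 : 0 ≤ m0 * (P1 - m1) * (P2 * P3 - m23) := mul_nonneg (mul_nonneg h0 (sub_nonneg.2 u1)) (sub_nonneg.2 u23)
  have t14 : 0 ≤ (P3 - m3) * (P1 * P2 - m12) * P0 := mul_nonneg (mul_nonneg (sub_nonneg.2 u3) (sub_nonneg.2 u12)) hP0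
  have t15 : 0 ≤ (P0 - m0) * (P1 - m1) * (P2 - m2) * P3 :=
    mul_nonneg (mul_nonneg (mul_nonneg (sub_nonneg.2 u0) (sub_nonneg.2 u1)) (sub_nonneg.2 u2)) hP3
  have t16 : 0 ≤ (P1 - m1) * (P2 - m2) * (P3 - m3) * P0 :=
    mul_nonneg (mul_nonneg (mul_nonneg (sub_nonneg.2 u1) (sub_nonneg.2 u2)) (sub_nonneg.2 u3)) hP0
  have e : 2 * (m0 * (P1 * P2 * P3 - m123)) + 2 * (m1 * (P0 * P2 * P3 - m023)) + 2 * (m2 * (P0 * P1 * P3 - m013))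
      + 2 * (m3 * (P0 * P1 * P2 - m012))
      + (P0 * P1 - m01) * (m23 - m2 * m3) + (P0 * P2 - m02) * (P1 * P3 - m13) + (P0 * P2 - m02) * (m13 - m1 * m3)
      + (P0 * P3 - m03) * (m12 - m1 * m2) + (P1 * P3 - m13) * (m02 - m0 * m2)
      + (P0 - m0) * (P3 - m3) * (m12 - m1 * m2) + (P0 - m0) * (P1 * P2 - m12) * P3 + (P0 - m0) * (P2 * P3 - m23) * P1
      + m0 * (P1 - m1) * (P2 * P3 - m23) + (P3 - m3) * (P1 * P2 - m12) * P0
      + (P0 - m0) * (P1 - m1) * (P2 - m2) * P3 + (P1 - m1) * (P2 - m2) * (P3 - m3) * P0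
      = 6 * (P0 * P1 * P2 * P3)
      - 2 * (m0 * m123 + m1 * m023 + m2 * m013 + m3 * m012)
      + (m0 * m1 * m23 + m0 * m2 * m13 + m0 * m3 * m12 + m1 * m2 * m03 + m1 * m3 * m02 + m2 * m3 * m01)
      - (m01 * m23 + m02 * m13 + m03 * m12)
      - m0 * m1 * m2 * m3 := by ring
  linarith [t1, t2, t3, t4, t5, t6, t7, t8, t9, t10, t11, t12, t13, t14, t15, t16, e, htop]

/-- **Sahi's `C₄` on the principal-cap stratum.**  Four increasing events with principal common part
`A ∩ B ∩ C ∩ D = {T | ↑c ⊆ T}` have `E₄(μ_p; 1_A, 1_B, 1_C, 1_D) ≥ 0` for every `p ∈ [0,1]^ι`. [this work] -/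
theorem sahiE4_nonneg_of_principalCap (p : ι → unitInterval) {A B C D : Set (Set ι)} (hA : IsUpperSet A) (hB : IsUpperSet B)
    (hC : IsUpperSet C) (hD : IsUpperSet D) (c : Finset ι)
    (hpc : ∀ T : Set ι, (T ∈ A ∧ T ∈ B ∧ T ∈ C ∧ T ∈ D) ↔ (↑c : Set ι) ⊆ T) :
    0 ≤ sahiE4 (prodBernoulli p) A B C D := by
  set μ := prodBernoulli p with hμ
  -- disjointified cores
  set KA : Finset ι := c.filter fun e => Set.univ \ {e} ∉ A with hKAdef
  set KB : Finset ι := (c.filter fun e => Set.univ \ {e} ∉ B) \ KA with hKBdef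
  set KC : Finset ι := ((c.filter fun e => Set.univ \ {e} ∉ C) \ KA) \ KB with hKCdef
  set KD : Finset ι := ((c \ KA) \ KB) \ KC with hKDdef
  have hcA : ∀ e ∈ KA, Set.univ \ {e} ∉ A := fun e he => (mem_filter.1 he).2
  have hcB : ∀ e ∈ KB, Set.univ \ {e} ∉ B := fun e he => (mem_filter.1 (mem_sdiff.1 he).1).2
  have hcC : ∀ e ∈ KC, Set.univ \ {e} ∉ C := fun e he => (mem_filter.1 (mem_sdiff.1 (mem_sdiff.1 he).1).1).2
  have hcD : ∀ e ∈ KD, Set.univ \ {e} ∉ D := by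
    intro e he hmem
    have hec : e ∈ c := (mem_sdiff.1 (mem_sdiff.1 (mem_sdiff.1 he).1).1).1
    have heA : e ∉ KA := (mem_sdiff.1 (mem_sdiff.1 (mem_sdiff.1 he).1).1).2
    have heB : e ∉ KB := (mem_sdiff.1 (mem_sdiff.1 he).1).2
    have heC : e ∉ KC := (mem_sdiff.1 he).2
    have hA' : Set.univ \ {e} ∈ A := by by_contra h; exact heA (mem_filter.2 ⟨hec, h⟩)
    have hB' : Set.univ \ {e} ∈ B := by by_contra h; exact heB (mem_sdiff.2 ⟨mem_filter.2 ⟨hec, h⟩, heA⟩)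
    have hC' : Set.univ \ {e} ∈ C := by
      by_contra h; exact heC (mem_sdiff.2 ⟨mem_sdiff.2 ⟨mem_filter.2 ⟨hec, h⟩, heA⟩, heB⟩)
    have hsub := (hpc _).1 ⟨hA', hB', hC', hmem⟩
    exact (hsub (mem_coe.2 hec)).2 rfl
  have hAK : A ⊆ {ω : Set ι | (↑KA : Set ι) ⊆ ω} := subset_cyl_of_core hA hcA
  have hBK : B ⊆ {ω : Set ι | (↑KB : Set ι) ⊆ ω} := subset_cyl_of_core hB hcB
  have hCK : C ⊆ {ω : Set ι | (↑KC : Set ι) ⊆ ω} := subset_cyl_of_core hC hcC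
  have hDK : D ⊆ {ω : Set ι | (↑KD : Set ι) ⊆ ω} := subset_cyl_of_core hD hcD
  -- disjointness, covering
  have dAB : Disjoint KA KB := disjoint_sdiff
  have dAC : Disjoint KA KC := by
    rw [Finset.disjoint_left]; intro e h1 h2; exact (mem_sdiff.1 (mem_sdiff.1 h2).1).2 h1
  have dAD : Disjoint KA KD := by
    rw [Finset.disjoint_left]; intro e h1 h2; exact (mem_sdiff.1 (mem_sdiff.1 (mem_sdiff.1 h2).1).1).2 h1
  have dBC : Disjoint KB KC := by
    rw [Finset.disjoint_left]; intro e h1 h2; exact (mem_sdiff.1 h2).2 h1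
  have dBD : Disjoint KB KD := by
    rw [Finset.disjoint_left]; intro e h1 h2; exact (mem_sdiff.1 (mem_sdiff.1 h2).1).2 h1
  have dCD : Disjoint KC KD := by
    rw [Finset.disjoint_left]; intro e h1 h2; exact (mem_sdiff.1 h2).2 h1
  have hcov : KA ∪ KB ∪ KC ∪ KD = c := by
    ext e
    simp only [mem_union]
    constructor
    · rintro (((h | h) | h) | h)
      · exact (mem_filter.1 h).1
      · exact (mem_filter.1 (mem_sdiff.1 h).1).1
      · exact (mem_filter.1 (mem_sdiff.1 (mem_sdiff.1 h).1).1).1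
      · exact (mem_sdiff.1 (mem_sdiff.1 (mem_sdiff.1 h).1).1).1
    · intro hec
      by_cases h1 : e ∈ KA
      · exact Or.inl (Or.inl (Or.inl h1))
      · by_cases h2 : e ∈ KB
        · exact Or.inl (Or.inl (Or.inr h2))
        · by_cases h3 : e ∈ KC
          · exact Or.inl (Or.inr h3)
          · exact Or.inr (mem_sdiff.2 ⟨mem_sdiff.2 ⟨mem_sdiff.2 ⟨hec, h1⟩, h2⟩, h3⟩)
  -- cylinder probabilities
  set P0 : ℝ := ∏ e ∈ KA, (p e : ℝ) with hP0def
  set P1 : ℝ := ∏ e ∈ KB, (p e : ℝ) with hP1def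
  set P2 : ℝ := ∏ e ∈ KC, (p e : ℝ) with hP2def
  set P3 : ℝ := ∏ e ∈ KD, (p e : ℝ) with hP3def
  have hPnn : ∀ K : Finset ι, 0 ≤ ∏ e ∈ K, (p e : ℝ) := fun K => prod_nonneg fun e _ => (p e).2.1
  -- upper bounds from cylinders
  have cyl2 : ∀ {X Y : Set (Set ι)} {K K' : Finset ι}, X ⊆ {ω : Set ι | (↑K : Set ι) ⊆ ω} → Y ⊆ {ω : Set ι | (↑K' : Set ι) ⊆ ω} →
      Disjoint K K' → μ.real (X ∩ Y) ≤ (∏ e ∈ K, (p e : ℝ)) * ∏ e ∈ K', (p e : ℝ) := by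
    intro X Y K K' hX hY hd
    have := measureReal_mono (μ := μ) (Set.inter_subset_inter hX hY)
    rwa [cyl_inter, real_cyl, prod_union hd] at this
  have cyl3 : ∀ {X Y Z : Set (Set ι)} {K K' K'' : Finset ι}, X ⊆ {ω : Set ι | (↑K : Set ι) ⊆ ω} →
      Y ⊆ {ω : Set ι | (↑K' : Set ι) ⊆ ω} → Z ⊆ {ω : Set ι | (↑K'' : Set ι) ⊆ ω} →
      Disjoint K K' → Disjoint K K'' → Disjoint K' K'' →
      μ.real (X ∩ Y ∩ Z) ≤ (∏ e ∈ K, (p e : ℝ)) * (∏ e ∈ K', (p e : ℝ)) * ∏ e ∈ K'', (p e : ℝ) := by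
    intro X Y Z K K' K'' hX hY hZ h1 h2 h3
    have := measureReal_mono (μ := μ) (Set.inter_subset_inter (Set.inter_subset_inter hX hY) hZ)
    rwa [cyl_inter, cyl_inter, real_cyl, prod_union (disjoint_union_left.2 ⟨h2, h3⟩), prod_union h1] at this
  have u0 : μ.real A ≤ P0 := by have := measureReal_mono (μ := μ) hAK; rwa [real_cyl] at this
  have u1 : μ.real B ≤ P1 := by have := measureReal_mono (μ := μ) hBK; rwa [real_cyl] at this
  have u2 : μ.real C ≤ P2 := by have := measureReal_mono (μ := μ) hCK; rwa [real_cyl] at this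
  have u3 : μ.real D ≤ P3 := by have := measureReal_mono (μ := μ) hDK; rwa [real_cyl] at this
  have u01 := cyl2 hAK hBK dAB
  have u02 := cyl2 hAK hCK dAC
  have u03 := cyl2 hAK hDK dAD
  have u12 := cyl2 hBK hCK dBC
  have u13 := cyl2 hBK hDK dBD
  have u23 := cyl2 hCK hDK dCD
  have u012 := cyl3 hAK hBK hCK dAB dAC dBC
  have u013 := cyl3 hAK hBK hDK dAB dAD dBD
  have u023 := cyl3 hAK hCK hDK dAC dAD dCD
  have u123 := cyl3 hBK hCK hDK dBC dBD dCD
  -- the top moment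
  have htop : P0 * P1 * P2 * P3 ≤ μ.real (A ∩ B ∩ C ∩ D) := by
    have hcyl : μ.real {ω : Set ι | (↑c : Set ι) ⊆ ω} = P0 * P1 * P2 * P3 := by
      rw [← hcov, real_cyl, prod_union (disjoint_union_left.2 ⟨disjoint_union_left.2 ⟨dAD, dBD⟩, dCD⟩),
        prod_union (disjoint_union_left.2 ⟨dAC, dBC⟩), prod_union dAB]
    rw [← hcyl]
    refine measureReal_mono fun ω hω => ?_
    obtain ⟨h1, h2, h3, h4⟩ := (hpc ω).2 hω
    exact ⟨⟨⟨h1, h2⟩, h3⟩, h4⟩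
  -- Harris
  have k02 := Literature.Probability.Percolation.prodBernoulli_harris_via_fibres p hA hC
  have k12 := Literature.Probability.Percolation.prodBernoulli_harris_via_fibres p hB hC
  have k13 := Literature.Probability.Percolation.prodBernoulli_harris_via_fibres p hB hD
  have k23 := Literature.Probability.Percolation.prodBernoulli_harris_via_fibres p hC hD
  have key := key_ineq4 (measureReal_nonneg (μ := μ) (s := A)) (measureReal_nonneg (μ := μ) (s := B))
    (measureReal_nonneg (μ := μ) (s := C)) (measureReal_nonneg (μ := μ) (s := D)) (hPnn KA) (hPnn KB) (hPnn KD)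
    u0 u1 u2 u3 u01 u02 u03 u12 u13 u23 u012 u013 u023 u123 htop k02 k12 k13 k23
  rw [sahiE4_def]
  linarith

/-- The same for a `Fin 4`-family, in the vocabulary of the master family (`sahiE (bernoulliWeight p) 4 (ind ∘ U)`). [this work] -/
theorem sahiE_four_ind_nonneg_of_principalCap (p : ι → unitInterval) (U : Fin 4 → Set (Set ι)) (hU : ∀ j, IsUpperSet (U j))
    (c : Finset ι) (hpc : ∀ T : Set ι, (∀ j, T ∈ U j) ↔ (↑c : Set ι) ⊆ T) :
    0 ≤ sahiE (bernoulliWeight p) 4 (fun j => ind (U j)) := by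
  have e : (fun j => ind (U j)) = ![ind (U 0), ind (U 1), ind (U 2), ind (U 3)] := by
    funext j; fin_cases j <;> rfl
  rw [e, sahiE_four_ind]
  refine sahiE4_nonneg_of_principalCap p (hU 0) (hU 1) (hU 2) (hU 3) c fun T => ?_
  rw [← hpc T]
  constructor
  · rintro ⟨h0, h1, h2, h3⟩ j
    fin_cases j
    · exact h0
    · exact h1
    · exact h2
    · exact h3
  · intro h; exact ⟨h 0, h 1, h 2, h 3⟩

/-- **`MasterFamilyNonneg 4` on the principal-cap stratum** (restatement). [this work] -/
theorem masterFamily_four_nonneg_of_principalCap (ι : Type) [Fintype ι] (p : ι → unitInterval) (U : Fin 4 → Set (Set ι))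
    (hU : ∀ j, IsUpperSet (U j)) (c : Finset ι) (hpc : ∀ T : Set ι, (∀ j, T ∈ U j) ↔ (↑c : Set ι) ⊆ T) :
    0 ≤ sahiE (bernoulliWeight p) 4 (fun j => ind (U j)) :=
  sahiE_four_ind_nonneg_of_principalCap p U hU c hpc

end PrincipalCapC3

end Summit.CriticalPhenomena.PercolationContinuityZ3.Theorems
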